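import Summits.BirchSwinnertonDyer.BirchSwinnertonDyer.Theses.SignedLowerHalves
import Summits.BirchSwinnertonDyer.BirchSwinnertonDyer.Theorems.SignedLowerHalvesSprungLowerHalfAtThreeSprungPair
import Summits.BirchSwinnertonDyer.BirchSwinnertonDyer.Theorems.SignedLowerHalvesSprungLowerHalfAtThreeChromaticReduction
import HarnessLib

/-!
# Route `SignedLowerHalves`, crux `SprungLowerHalfAtThree` (item stmt-BirchSwinnertonDyer-19003): the ROUTE
# DECL ITSELF, by name, characterised in the kernel — `SprungLowerHalfAtThree` ⟸ (modularity ∧ period unit ∧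
# GZK ∧ entire `L`) ∧ (conv₀) ∧ (low₀), and `SprungLowerHalfAtThree` ⟹ modularity-on-X8 ∧ [(conv₀) ∧ (low₀)
# granted GZK] (cell `bsd-ssimc`, seat `bsd-ssimc-k3-c5` gen 2; a `--supports … --as helper`
# file, closes nothing)

PARTITION (cell bsd-ssimc): X8 (A8) — the whole class (crux 5 is typed rank-free) — types-the-object-of;
closes NONE. THEOREMS ONLY; nothing booked; nothing about the crux is asserted.

The two companion files of gen 0 treat the REGISTERED STUB HEADERS: `…SprungPair.lean` (p417663: stub (A)
modulo modularity + the period-ratio unit at `3`) and `…ChromaticReduction.lean` (p417882: stub (B) ⟺ the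
two Λ-free inputs (conv₀) «X8 ∧ `Sel_{3^∞}(E/ℚ)` finite ⇒ `r_an = 0`» and (low₀) «X8 ∧ `r_an = 0` ⇒
`ord_3 #Ш_an ≤ ord_3 #Ш`»). This file says the same about the ROUTE DECLARATION
`Summit.BirchSwinnertonDyer.BirchSwinnertonDyer.Theses.SignedLowerHalves.SprungLowerHalfAtThree` BY NAME
(importing the route file), so that the tribunal / planner read the crux's exact strength off kernel
theorems whose types mention the decl:

* `sprungLowerHalfAtThree_of_corankZero_inputs` — modularity (`exists_isNewformOf`), the period-ratio unit
  at `3`, GZK, `hasEntireLFunction_rat` (PUBLISHED named facts) and the two OPEN Λ-free inputs (conv₀),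
  (low₀) IMPLY the crux (composition of the two stub theorems in the BC3 skeleton's order);
* `isNewformOf_of_sprungLowerHalfAtThree` — the crux IMPLIES modularity for every X8 curve (its clause (A)
  has no hypothesis slot: the kernel form of the gen-0 finding R1 «crux 5 cannot close without the
  Modularity Theorem as a tree theorem»);
* `corankZero_inputs_of_sprungLowerHalfAtThree` — the crux IMPLIES, granted GZK, at
  every X8 pair with `Sel_{3^∞}(E/ℚ)` finite: `L(E,1) ≠ 0` (the corank-zero converse) AND
  `MissingLowerBoundAt W 3` (the rank-0 `3`-part lower bound) — i.e. (conv₀) ∧ (low₀).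

So, modulo the published facts, `SprungLowerHalfAtThree` ⟺ Modularity-on-X8 ∧ (conv₀) ∧ (low₀): its
Λ-adic dress (newform, Sprung pair, `ξ`, `h`) carries no information beyond the constant term, exactly as
the planner's TENURE NOTE v2 anticipated. Sources for (low₀)/(conv₀) in print: Sprung, Adv. Math. 449
(2024) Thm. 1.1/Cor. 1.2 (refereed, CONDITIONAL on Conj. 3.33); Castella–Çiperiani–Skinner–Sprung
arXiv:1804.10993 Thm. C (PRE; semistable) and Fouquet–Wan arXiv:2107.13726 Cor. 5.3/5.4 (PRE; FW locus) —
the loci and binders of the companion files `…Semistable.lean`, `…FWLocus.lean`, `…FWLocusAllRanks.lean`;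
no refereed unconditional source exists (cell TARGET §1.3). Nothing here is new mathematics.

References: [Sprung2012] Main Conj. 1.3/7.21, Prop. 7.19; [Sprung2017] Thm. 1.12, Cor. 4.11; [Sprung2024]
Thm. 1.1, Cor. 1.2, Lemmas 5.5–5.9; [DiamondShurman2005] Thm. 8.8.3; [GreenbergVatsal2000] Rem. 3.4;
[GreenbergLNM1716] §4; [Miller2011LMS] Def. 1.1.
-/

set_option autoImplicit false
set_option linter.dupNamespace false

noncomputable section

open scoped Classical MatrixGroups ModularForm

open CongruenceSubgroup WeierstrassCurve Literature.NumberTheory.EllipticCurves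
  Literature.NumberTheory.EllipticCurves.ModularForms
  Literature.NumberTheory.EllipticCurves.Rank1Residual
  Literature.NumberTheory.EllipticCurves.Rank1Residual.Typed
  Literature.NumberTheory.EllipticCurves.Sprung2017
  Summit.BirchSwinnertonDyer.Rank1Residual.Supersingular

namespace Summit.BirchSwinnertonDyer.BirchSwinnertonDyer.Theorems

/-- **The crux FROM its inputs.** Granted the PUBLISHED named facts — modularity `exists_isNewformOf`
(`hmodE`), the period-ratio unit at `3` (`hper`), GZK (`hGZK`), `hasEntireLFunction_rat` (`hmod`) — and the
two OPEN Λ-free inputs displayed as binders, (conv₀) «X8 ∧ `Sel_{3^∞}(E/ℚ)` finite ⇒ `r_an = 0`» and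
(low₀) «X8 ∧ `r_an = 0` ⇒ `MissingLowerBoundAt W 3`», the route decl
`Theses.SignedLowerHalves.SprungLowerHalfAtThree` holds: objects from `stub_sprungPair_of_modularity_of_periodUnit`,
then clause (B) for them from `stub_chromaticDivisibility_of_corankZero_inputs` (the BC3 skeleton's
composition `SprungLowerHalfAtThree_of`, with the stubs replaced by their conditional closures).
CONDITIONAL; (conv₀), (low₀) are OPEN class-wide and NOT claimed; closes nothing.
[cite: Sprung2017, Thm. 1.12 and Cor. 4.11] [cite: DiamondShurman2005, Thm. 8.8.3]
[cite: GreenbergVatsal2000, §3 Remark 3.4] [cite: Miller2011LMS, Def. 1.1] -/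
theorem sprungLowerHalfAtThree_of_corankZero_inputs (hmodE : exists_isNewformOf)
    (hper : realPeriodRat_eq_unit_mul_plusPeriod_three)
    (hGZK : rank_eq_analyticRank_of_analyticRank_le_one) (hmod : hasEntireLFunction_rat)
    (hconv : ∀ (W : WeierstrassCurve ℚ) [W.IsElliptic] [W.IsGloballyMinimal],
      ClassX8 W 3 → Finite (W.selmerGroupPInfty 3) → W.analyticRank = 0)
    (hlow : ∀ (W : WeierstrassCurve ℚ) [W.IsElliptic] [W.IsGloballyMinimal],
      ClassX8 W 3 → W.analyticRank = 0 → MissingLowerBoundAt W 3) :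
    Summit.BirchSwinnertonDyer.BirchSwinnertonDyer.Theses.SignedLowerHalves.SprungLowerHalfAtThree := by
  unfold Summit.BirchSwinnertonDyer.BirchSwinnertonDyer.Theses.SignedLowerHalves.SprungLowerHalfAtThree
  intro W _ _ p _ hX
  obtain ⟨N, hN, f, ϖ, Lsharp, Lflat, hf, hϖ, hSP⟩ :=
    stub_sprungPair_of_modularity_of_periodUnit hmodE hper W p hX
  obtain ⟨c, ξ, hK, hdiv⟩ := stub_chromaticDivisibility_of_corankZero_inputs hGZK hmod hper hconv hlow
    W p hX N hN f ϖ Lsharp Lflat hf hϖ hSP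
  exact ⟨N, hN, f, ϖ, Lsharp, Lflat, c, ξ, hf, hϖ, hSP, hK, hdiv⟩

/-- **The crux IMPLIES modularity on X8** (its clause (A) has no hypothesis slot): if
`Theses.SignedLowerHalves.SprungLowerHalfAtThree` holds then every globally minimal `E/ℚ` with good
supersingular `3` and `a_3 = ±3` has a newform `f ∈ S₂(Γ₀(N))` with `aₙ(f) = aₙ(E)` — the Modularity
Theorem on class X8, which the tree holds only as the named fact `exists_isNewformOf`. Kernel form of the
gen-0 finding R1: the item cannot close unconditionally before modularity is a tree theorem. Pure logic.
[cite: DiamondShurman2005, Thm. 8.8.3 (the fact the crux presupposes)] -/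
theorem isNewformOf_of_sprungLowerHalfAtThree
    (h : Summit.BirchSwinnertonDyer.BirchSwinnertonDyer.Theses.SignedLowerHalves.SprungLowerHalfAtThree)
    (W : WeierstrassCurve ℚ) [W.IsElliptic] [W.IsGloballyMinimal] (hX : ClassX8 W 3) :
    ∃ (N : ℕ) (_ : NeZero N) (f : CuspForm (Gamma0 N) 2), IsNewformOf W f := by
  obtain ⟨N, hN, f, -, -, -, -, -, hf, -⟩ := h W 3 hX
  exact ⟨N, hN, f, hf⟩

/-- **The crux IMPLIES its two Λ-free inputs.** If `Theses.SignedLowerHalves.SprungLowerHalfAtThree` holds,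
then — granted only GZK (`hGZK`; the period fact is not needed in this direction, the colour constants
being `3`-adic units on X8) — at every X8 pair with `Sel_{3^∞}(E/ℚ)` finite: `L(E,1) ≠ 0` (so `r_an = 0`: the corank-zero `3`-converse (conv₀)) AND `ord_3 #Ш_an ≤ ord_3 #Ш`
(`MissingLowerBoundAt W 3`, (low₀)). Proof: take the crux's own objects `(f, ϖ, L♯, L♭, •, ξ, h)` and
apply `entireLFunction_one_ne_zero_and_missingLowerBoundAt_of_chromaticDatum` (Kim's identity makes
`ξ(0) ≠ 0`, the divisibility and (P•) make `[0]⁺_f ≠ 0`, then the tree road). With the first theorem: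
modulo the published facts, the crux ⟺ Modularity-on-X8 ∧ (conv₀) ∧ (low₀). CONDITIONAL; closes nothing.
[cite: Sprung2017, Cor. 4.11 (table of special values)] [cite: GreenbergLNM1716, §4 p. 103]
[cite: Miller2011LMS, Def. 1.1] -/
theorem corankZero_inputs_of_sprungLowerHalfAtThree
    (h : Summit.BirchSwinnertonDyer.BirchSwinnertonDyer.Theses.SignedLowerHalves.SprungLowerHalfAtThree)
    (hGZK : rank_eq_analyticRank_of_analyticRank_le_one)
    (W : WeierstrassCurve ℚ) [W.IsElliptic] [W.IsGloballyMinimal] (hX : ClassX8 W 3)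
    (hfin : Finite (W.selmerGroupPInfty 3)) :
    W.entireLFunction 1 ≠ 0 ∧ MissingLowerBoundAt W 3 := by
  obtain ⟨N, hN, f, ϖ, Lsharp, Lflat, c, ξ, hf, hϖ, hSP, hK, hdiv⟩ := h W 3 hX
  haveI := hN
  exact entireLFunction_one_ne_zero_and_missingLowerBoundAt_of_chromaticDatum W 3 hGZK (by decide)
    hX.2.1.1 (ClassX8.irr W 3 hX) hf hϖ hSP c (ClassX8.not_dvd_chromaticConst' W 3 hX c) hfin ξ hK hdiv

/-- **Corollary: the crux IMPLIES the rank-0 `3`-part of BSD's lower half on all of X8** — for every X8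
pair of analytic rank `0`, `ord_3 #Ш_an ≤ ord_3 #Ш` (GZK: `r_an = 0` ⇒ `E(ℚ)`, `Ш` finite ⇒ `Sel_{3^∞}(E/ℚ)`
finite ⇒ previous theorem). This is the (low₀) input the leaf `SignedSupersingular` consumes on its branch
`r_an = 0 ∧ surj` (via `X8.missingInputAt_of_chromaticLowerDivisibility_of_surj`); the crux delivers it on
the whole class. CONDITIONAL on the crux; closes nothing. [cite: GreenbergLNM1716, §4 p. 103]
[cite: Miller2011LMS, Def. 1.1] -/
theorem missingLowerBoundAt_of_sprungLowerHalfAtThree_of_analyticRank_eq_zero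
    (h : Summit.BirchSwinnertonDyer.BirchSwinnertonDyer.Theses.SignedLowerHalves.SprungLowerHalfAtThree)
    (hGZK : rank_eq_analyticRank_of_analyticRank_le_one)
    (W : WeierstrassCurve ℚ) [W.IsElliptic] [W.IsGloballyMinimal] (hX : ClassX8 W 3)
    (hr : W.analyticRank = 0) : MissingLowerBoundAt W 3 := by
  have hr0 : W.mordellWeilRank = 0 := (hGZK W (by omega)).1.trans hr
  haveI hfinE : Finite W.toAffine.Point := W.mordellWeilRank_eq_zero_iff_finite.mp hr0
  haveI hfinSha : Finite W.sha := (hGZK W (by omega)).2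
  have hSel : Nat.card (W.selmerGroupPInfty 3) = Nat.card (AddCommGroup.primaryComponent W.sha 3) :=
    W.natCard_selmerGroupPInfty_eq_natCard_primaryComponent_sha 3
  have hcardpos : 0 < Nat.card (AddCommGroup.primaryComponent W.sha 3) := Nat.card_pos
  have hfin : Finite (W.selmerGroupPInfty 3) :=
    Nat.finite_of_card_ne_zero (by rw [hSel]; exact hcardpos.ne')
  exact (corankZero_inputs_of_sprungLowerHalfAtThree h hGZK W hX hfin).2

end Summit.BirchSwinnertonDyer.BirchSwinnertonDyer.Theorems

end
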